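import Summits.BirchSwinnertonDyer.Rank1Residual.X11b.KolyvaginShaOrderAtPrimeOfProp37
import Summits.BirchSwinnertonDyer.Rank1Residual.X11b.KolyvaginHGZOfGross1991
import HarnessLib

/-!
# Kolyvagin's ORDER bound `#Ш(E/K)[p^∞] ≤ p^{2M₀}` at ONE odd surjective prime `p` WITHOUT the
# Kodaira–Néron sub-class (KN_p) — modulo TWO NAMED facts (Gross 1991 Prop. 3.7 (2) and §6 /
# [GZ86, III (3.1)] BY NAME) and the Cassels–Tate inputs

Cell `b2b-bsdres`, team x11b3 (N8/O2 = X11b @ 3); seat x11b3-p2 GEN 54 (unit claimed D-0075 →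
BSD:K2/P4 «Kolyvagin-in-kernel»; this is the ladder-P4 ORDER form).  Summit-side THEOREM-ONLY file
(no definition, no named fact, no `sorry`); `K : Type`; a general odd prime `p`.

HONEST FRAMING (cell `b2b-bsdres`, run/shared/lean/b2b/bsd-rank1-residual/, verbatim in every
file): the goal of the cell is to DELETE the COMBINATION-SHAPED residual classes of the
Birch–Swinnerton-Dyer formula for ALL analytic-rank `≤ 1` elliptic curves over `ℚ` — "full BSD
formula for every rank `≤ 1` curve in class `C`" assembled STRICTLY from published theorems — so
that the rank-`≤ 1` remainder becomes exactly the CONSTRUCTION-SHAPED classes, which are TYPED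
(missing-input `Prop`s), NOT attempted.  This is not "finishing BSD".  Nothing here is booked; no
mark / label / count / tier moves; X11b @ `p` stays OPEN / CONSTRUCTION-SHAPED (Kolyvagin bounds
`Ш` relative to the Heegner index; it is not `BSD_p`).

WHAT THIS FILE DOES.  The ORDER form of record (`X11b/KolyvaginShaOrderAtPrimeOfProp37`, x11b3-p2
GEN 53: `Ш(E/K)[p^∞]` finite ∧ `p^{M₀}`-torsion ∧ `#Ш(E/K)[p^∞] ≤ p^{2M₀}` ∧ `ord_p # ≤ 2M₀` for
`p^{M₀} x₀ = y_K ∉ p^{M₀+1} E(K)`, modulo the NAMED fact `GrossLMS1991.prop37_2_reductionCongruence N W K p`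
and the displayed Cassels–Tate inputs) is stated on (KN_p) (`hKNm`, `hKNa`), which SUPPLIED its
receptacle binder `hGZ` ([GZ86, III (3.1)]) by Kodaira–Néron.  THIS FILE re-issues it WITHOUT
(KN_p): `hGZ` is taken BY NAME from the Literature fact `Gross1991_heegnerPoint_sub_ratTorsion_mem_E0`
through `KolyvaginHloc.hGZ_of_gross1991E0` (`X11b/KolyvaginHGZOfGross1991`, this GEN); the binders
`hKNm` / `hKNa` are REPLACED by `(hE0 : Gross1991_heegnerPoint_sub_ratTorsion_mem_E0)`, every other
binder (incl. the Cassels–Tate inputs `e`, `inv`, `hPT'`, `hinv`, `hH3`, `hB`, `hPτ`) and the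
conclusion VERBATIM; proof = the hGZ-hypothesis parent
`KolyvaginOrder.card_sha_primary_le_at_of_leafInputs_of_poitouTate_of_localDuality` (x11b3 (P2-QUANT))
with `hPT`, `hrec`, `hCM`, `h53` discharged by the tree theorems as in GEN 52 and `hGZ`, `hγ` under
the END's own hypotheses.  Net (honest): for `E/ℚ` globally minimal without CM at `N = N_E`, `K`
imaginary quadratic Heegner with `d_K ∉ {−3, −4}`, `p` odd with `ρ̄_{E,p}` onto and NO condition on
Tamagawa numbers / Kodaira types, McCallum's `#Ш(E/K)[p^∞] ≤ p^{2 M₀}` (`M₀` = the `p`-divisibility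
of `y_K` in `E(K)`) is a theorem CONDITIONAL on the two NAMED PUBLISHED facts + the Cassels–Tate
inputs; neither fact discharged (both XL); nothing booked.  The `p = 3` class forms are
`X11b/Three/KolyvaginShaOrderThreeOfGross1991`.

## What is proved

* `KolyvaginDischarged.card_sha_primary_le_at_of_gross1991E0_of_localDuality_of_prop37`.

## References

* [McCallumLMS1991] W. G. McCallum, LMS LNS 153 (1991), §1 Theorem (Kolyvagin), §4, Thm. 5.4,
  Cor. 5.6, Lemma 5.1.  [GrossLMS1991] Thm. 1.3 (2), §2 Thm. 2.2 (2), §3 Prop. 3.7 (2) (p. 240),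
  §6 Prop. 6.2 (1) and its proof (p. 245).  [GrossZagier1986Heegner] III (3.1) (p. 256).
* [MilneADT2006] Ch. I §6, Thm. 6.13 (a) (Cassels–Tate).  [SilvermanAEC2009] VII.1 Prop. 1.3 (b).

presearch: `lean search 'of_gross1991E0_of_localDuality'` → none before this GEN; parents = the tree
ENDs named above; [corpus: book:editornd-l-functions-arithmetic p0222:L1, p0217:L19–L22]; nothing minted.
-/

noncomputable section

namespace Summit.BirchSwinnertonDyer.Rank1Residual.X11b.KolyvaginDischarged

open scoped Classical
open WeierstrassCurve Field NumberField IsDedekindDomain Function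
open Literature.NumberTheory.EllipticCurves Literature.NumberTheory.GaloisRepresentations
open Literature.NumberTheory.EllipticCurves.RingClassField
open Literature.NumberTheory.EllipticCurves.ModularForms
open Literature.NumberTheory.DiophantineGeometry Literature.NumberTheory.DiophantineGeometry.TateAlgorithm
open Literature.NumberTheory.GaloisCohomology
open Literature.NumberTheory.GaloisRepresentations.DiscreteGaloisModule (mu MuCarrier)
open Literature.NumberTheory.EllipticCurves.GrossLMS1991 (prop37_2_reductionCongruence)

-- `LocallyCompactSpace Γ_K` / `CharZero` of completions, as in the tree's Cassels–Tate files.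
attribute [local instance] absoluteGaloisGroup_compactSpace charZero_placeCompletion

variable {K : Type} [Field K] [NumberField K] {N : ℕ} {W : WeierstrassCurve ℚ}

/-- **Kolyvagin's order bound at ONE odd surjective prime `p` — NO Kodaira–Néron hypothesis:
`Ш(E/K)[p^∞]` finite ∧ `p^{M₀}`-torsion ∧ `#Ш(E/K)[p^∞] ≤ p^{2M₀}` ∧ `ord_p # ≤ 2M₀` — modulo the TWO
NAMED facts `GrossLMS1991.prop37_2_reductionCongruence N W K p` and
`Gross1991_heegnerPoint_sub_ratTorsion_mem_E0` and the Cassels–Tate inputs, no inline cite-only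
input** — for `p^{M₀} x₀ = y_K ∉ p^{M₀+1}E(K)`, `M₀ ≥ 1`.  The hGZ-hypothesis parent
`KolyvaginOrder.card_sha_primary_le_at_of_leafInputs_of_poitouTate_of_localDuality` with `hPT`,
`hrec`, `hCM`, `h53` SUPPLIED by the tree theorems, `hGZ` := `KolyvaginHloc.hGZ_of_gross1991E0 hE0`
and `hγ` := `hγ.endBinder`, both under the END's own hypotheses `_hE`, `_hD`, `hp`, `hp2`, `_hρ`,
`hN`; the binders `hKNm` / `hKNa` of the (KN_p) twin
`card_sha_primary_le_at_of_kodairaNeron_of_localDuality_of_prop37` are GONE, every other binder (incl.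
the displayed Cassels–Tate inputs) and the conclusion VERBATIM.  CONDITIONAL on EXACTLY the two named
facts (PUBLISHED, NOT discharged) + `hN` + the Cassels–Tate inputs; nothing booked; no mark / count
/ tier moves. [cite: McCallumLMS1991, §1 Theorem (Kolyvagin), Cor. 5.6]
[cite: GrossLMS1991, Thm. 2.2 (2), §3 Prop. 3.7 (2) (p. 240), §6 Prop. 6.2 (1) (p. 245)]
[cite: GrossZagier1986Heegner, III (3.1) Proposition, p. 256] [cite: MilneADT2006, Ch. I §6, Thm. 6.13(a)] -/
theorem card_sha_primary_le_at_of_gross1991E0_of_localDuality_of_prop37 [NeZero N]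
    [W.IsGloballyMinimal] {p : ℕ} (hp : p.Prime) (hp2 : p ≠ 2)
    (hN : ∀ [W.IsElliptic], N = W.conductorNorm ℤ)
    (hE0 : Gross1991_heegnerPoint_sub_ratTorsion_mem_E0)
    (hγ : prop37_2_reductionCongruence N W K p) :
    ∀ [W.IsElliptic] (_hE : ¬ W.HasCM) (_hK : IsImaginaryQuadratic K)
      (_hD : NumberField.discr K ≠ -3 ∧ NumberField.discr K ≠ -4)
      (_hH : SatisfiesHeegnerHypothesis N K)
      {P : (W.baseChange K).toAffine.Point} (_hP : IsHeegnerPoint N W K P)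
      (_hnt : ¬ IsOfFinAddOrder P) (_hρ : W.HasSurjectiveModNGaloisRep p)
      {M₀ : ℕ} (_hM₀ : 1 ≤ M₀) [NeZero (p ^ M₀)] {c : K ≃ₐ[ℚ] K} (_hc : c ≠ 1) (_hcc : c * c = 1)
      {x₀ : (W.baseChange K).toAffine.Point} (_hx₀ : p ^ M₀ • x₀ = P)
      (_hmax : ∀ Q : (W.baseChange K).toAffine.Point, p ^ (M₀ + 1) • Q ≠ P)
      (e : geomTorsion (W.baseChange K) ((p ^ M₀ * p ^ M₀ : ℕ) : ℤ) →
        geomTorsion (W.baseChange K) ((p ^ M₀ * p ^ M₀ : ℕ) : ℤ) → AlgebraicClosure K)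
      (hμ : ∀ S T, e S T ^ (p ^ M₀ * p ^ M₀) = 1)
      (hadd₁ : ∀ S₁ S₂ T, e (S₁ + S₂) T = e S₁ T * e S₂ T)
      (hadd₂ : ∀ S T₁ T₂, e S (T₁ + T₂) = e S T₁ * e S T₂)
      (hgal : ∀ (σ : absoluteGaloisGroup K) (S T : geomTorsion (W.baseChange K) ((p ^ M₀ * p ^ M₀ : ℕ) : ℤ)),
        σ • e S T = e (σ • S) (σ • T))
      (halt : ∀ T, e T T = 1) (hnondeg : ∀ T, (∀ S, e S T = 1) → T = 0)
      (inv : LocalInvariants K (p ^ M₀ * p ^ M₀)) (hPT' : inv.SumInvLocalizationEqZero)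
      (hinv : ∀ v : HeightOneSpectrum (𝓞 K), Injective (inv (Sum.inr v)))
      (hH3 : ∀ x : galoisCohomology (mu K (p ^ M₀ * p ^ M₀)) 3,
        (∀ v : Place K, galoisCohomology.localization (mu K (p ^ M₀ * p ^ M₀)) v 3 x = 0) → x = 0)
      (hB : Literature.GroupTheory.FiniteAbelian.IsLevelPairing (p ^ M₀)
        (ctLevelPairing (W.baseChange K) (p ^ M₀) e hμ hadd₁ hadd₂ hgal inv halt hPT' hH3
          (localTerm_finite_support (W := W.baseChange K) (m := p ^ M₀) (e := e) (hμ := hμ)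
            (hadd₁ := hadd₁) (hadd₂ := hadd₂) (hgal := hgal) halt inv)))
      (hPτ : ∀ z ∈ selmerGroup (W.baseChange K) ((p ^ M₀ * p ^ M₀ : ℕ) : ℤ),
        ∀ t ∈ selmerGroup (W.baseChange K) ((p ^ M₀ * p ^ M₀ : ℕ) : ℤ),
        ctGeneralFun (W.baseChange K) (p ^ M₀) e hμ hadd₁ hadd₂ hgal inv
            (torsionH1ToH1 (W.baseChange K) _ (conjAct W c _ z))
            (torsionH1ToH1 (W.baseChange K) _ (conjAct W c _ t)) =
          ctGeneralFun (W.baseChange K) (p ^ M₀) e hμ hadd₁ hadd₂ hgal inv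
            (torsionH1ToH1 (W.baseChange K) _ z) (torsionH1ToH1 (W.baseChange K) _ t)),
      Finite (AddCommGroup.primaryComponent (W.baseChange K).sha p) ∧
      (∀ c ∈ AddCommGroup.primaryComponent (W.baseChange K).sha p, p ^ M₀ • c = 0) ∧
      Nat.card (AddCommGroup.primaryComponent (W.baseChange K).sha p) ≤ p ^ (2 * M₀) ∧
      padicValNat p (Nat.card (AddCommGroup.primaryComponent (W.baseChange K).sha p)) ≤ 2 * M₀ := by
  intro _ hE hK hD hH P hP hnt hρ
  exact KolyvaginOrder.card_sha_primary_le_at_of_leafInputs_of_poitouTate_of_localDuality hp hp2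
    (poitouTate_sum_localTatePairing_eq_zero_holds K) hN
    (heegnerPointOfConductor_one_galoisConj_holds N W K) (KolyvaginLeaves.hCM_holds N W K p)
    (@fun _ ↦ KolyvaginLeaves.h53_holds hN p)
    (@fun _ hK' hH' Dt _ ι _ _ _ hn hKol d ↦
      KolyvaginHloc.hGZ_of_gross1991E0 hE0 hN hE hK' hD hH' ι Dt hp hp2 hρ hn hKol d)
    (hγ.endBinder (@fun _ ↦ hE) hD hp hp2 (@fun _ ↦ hρ) hN) hE hK hD hH hP hnt hρ

end Summit.BirchSwinnertonDyer.Rank1Residual.X11b.KolyvaginDischarged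

end
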